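import Summits.BirchSwinnertonDyer.BirchSwinnertonDyer.Theses.DerivedKatoValuationDoor
import Summits.BirchSwinnertonDyer.BirchSwinnertonDyer.Theses.PAdicOrderV2
import Summits.BirchSwinnertonDyer.BirchSwinnertonDyer.Theorems.Rank2ObservatoryPadicAtlasR2A00
import Summits.BirchSwinnertonDyer.BirchSwinnertonDyer.Theorems.DerivedKatoValuationDoorDerivedKatoDoorStubSandwichFromDA
import Literature.NumberTheory.EllipticCurves.PAdicLFunction
import Literature.NumberTheory.EllipticCurves.CanonicalPAdicHeightJunkSigmaProofs
import HarnessLib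

/-!
# Crux `DerivedKatoDoor` (stmt-BirchSwinnertonDyer-23024) — birth skeleton `Lines/birth.lean`

Route `DerivedKatoValuationDoor` (route-BirchSwinnertonDyer-DerivedKatoValuationDoor, born draft
2026-08-28T17:34Z, commit e4c02a855766), crux #2 (rank 2, card item K1 = D-K₂, deciding): for every
`E/ℚ` (global minimal model `W`) of analytic rank `2` and every DOOR PRIME `p` (`5 ≤ p`, good ordinary,
`ρ̄_{E,p}` onto), EVERY admissible Kato zeta class `z₀ ∈ 𝐇¹ = I.H` (tree predicate
`Kato2004.IsAdmissibleZetaClass`, `= Λˣ·𝐳_{γ_W} ∩ 𝐇¹` by print) satisfies: no `p^m · z₀` lies in `T²·𝐇¹`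
(`v_T(z₀) ≤ 1` in `𝐇¹ ⊗ ℚ`; `T = X ∈ Λ = ℤ_p⟦T⟧`). The crux is FIXED (decl
`Summit.BirchSwinnertonDyer.BirchSwinnertonDyer.Theses.DerivedKatoValuationDoor.DerivedKatoDoor`).
BSD is not proved by any of this.

PROVENANCE. The route planner's registered birth skeleton (gate evidence
`DerivedKatoDoor_birth_registered.lean`, sha16 c24c089348ad9d31, stubs `stub_sandwichFromDA`,
`stub_analyticOrderTwoAndLoc`, `stub_rung389a1_5`, composition `DerivedKatoDoor_of`) could not be
published by the planner (one-writer rule) and is NOT readable from the lead's seat (the gate evidence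
store and the planner's folder are not mounted in prover jails). Revision 1 of this file (commit
2f26b6fb530c) was the lead's faithful RECONSTRUCTION from the ledger's registered stub list
(`stub_analyticOrderTwoAndLoc`, `stub_rung389a1_5` verbatim; `stub_sandwichFromDA`, registered as the
bare name `SandwichFromDA`, re-typed from the route header's TWO-LAYER PLAN and SPELLED OUT so that a
stub worker's `Theorems/` file can state it without importing this file). Revision 2 (this file) is
the lead's first RESHAPE (L4): the planner's open stub `stub_analyticOrderTwoAndLoc` («a = 2 ⇒ ρ_p ≤ 2 ∧
Loc_p») is the conjunction of two INDEPENDENT open statements with different owners in the tree, so it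
is split at the skeleton level into `stub_ordLeTwoOfAnalyticRankTwo` (the `a = 2` slice of the existing
crux `PAdicOrderV2.PAdicOrderComparisonR2`) and `stub_locPOfAnalyticRankTwo` (a consequence of the
route's declared residual `PointsTwo` plus print); the planner's stub is their conjunction on the nose
(certificate `analyticOrderTwoAndLoc_of_split`). `stub_sandwichFromDA` and `stub_rung389a1_5` (held by
the seats bsd-line-dkd-w2 / -w3) are byte-identical to revision 1. Four stubs (stubs_max = 4).

## Line `birth` — the sandwich `(D-A₂ ∧ Loc_p) ⇒ D-K₂` and its two open inputs

Write `ρ_p := ord_{T=0} L_p(f, α_p; T) ∈ ℕ∞` (`L_p = padicLFunction f (unitRoot W p)`, the tree's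
Mazur–Tate–Teitelbaum unit-root `p`-adic `L`-function of a newform `f` of `W`), `v := v_T(z₀)` (largest
`k` with `p^m z₀ ∈ T^k 𝐇¹` for some `m`), `Loc_p(W,p)` := «some integral global class
`x ∈ H¹(ℤ[1/p], T_pW)` localises at `p` to a Kummer class of NON-ZERO formal logarithm»
(`Kato2004.HasLocPKummerLog`; equivalently `loc_p(H¹(ℤ[1/p], V)) = H¹_f(ℚ_p, V)`).

REVISION 3 (lead, after the wave): seat w2 LANDED the sandwich modulo two typed Literature named facts
(`Theorems.DerivedKatoValuationDoor.stub_sandwichFromDA_of_facts`), so the sandwich is now DERIVED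
(`sandwichFromDA_of_stubs`) from the two print-fact stubs `stub_colemanMapAdmissibleZeta` /
`stub_hasLocPKummerLogOfExistsLogNeZero`; seat w3 replied stub-misstated on the rung and LANDED the cell's
decidable content (`door_389a1_five`, `order_padicLFunction_le_two_389a1_five`, `rung389a1_five_of_sandwich`),
so the rung is no longer a stub. This line is the UNREGISTERED alternative since the lead PICKED `lower`
(2026-08-28, PICKED.md); it is kept current for the record. Four stubs: two print named facts, two open.

STUBS (`sorry` only here):
* (r1/r2) `stub_sandwichFromDA` — PRINT; now DERIVED as `sandwichFromDA_of_stubs` from stubs 1a/1b below.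
  The print chain: at a door prime, `ρ_p ≤ 2` (for every newform of `W`) and `Loc_p` force `v ≤ 1`. Chain: if `p^m z₀ = T² h` then, with `Col` Kato's ordinary Coleman map on
  `𝐇¹ → H¹_Iw(ℚ_p, T) → Λ` (Thm. 16.6 (2) / Prop. 17.11: `Col(loc z₀) ≐ L_p` up to a unit, a `p`-power
  and the Λ-adic multiplier `M̃` of the admissible class, whose augmentation is `≠ 0` —
  `constantCoeff_katoMultiplier_ne_zero`), `ρ_p = 2 + ord_T Col(loc h)`; and `Col(loc h)(𝟙) =
  c · exp*_ω(loc_p h(𝟙))` with `c = (1 − α⁻¹)(1 − p⁻¹α⁻¹)·(period unit) ≠ 0` at good ordinary `p`;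
  by Poitou–Tate the image of `H¹(ℤ[1/p], V_pW)` in `H¹(ℚ_p, V_pW) ≅ ℚ_p²` is ONE line
  (`dim H¹_rel − dim H¹_str = 2 − 1 = 1`), so `Loc_p` makes it the line `H¹_f = ker exp*`, whence
  `exp*(loc_p h(𝟙)) = 0`, `T ∣ Col(loc h)`, `ρ_p ≥ 3` — contradiction. Sources: Kato 2004 Thm. 16.6,
  Prop. 17.11, §17.13; Perrin-Riou 1993 §3.3–3.4; Burns–Kurihara–Sano arXiv:1910.07404 Lemma 6.12–6.14;
  Kobayashi (KP07) Lemma 1.4 (the line at `p`). Size L–XL to formalise (ordinary Coleman map on the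
  pinned `I.H`, its value law at `𝟙`, Poitou–Tate for `T_pE` over `ℤ[1/p]` — the last is in the tree
  in the currency of `Rank1Residual.Additive.exists_hasLocPKummerLog_of_mem_integralH1`).
* `stub_ordLeTwoOfAnalyticRankTwo` — OPEN (the lead's): `a = 2 ⇒ ρ_p ≤ 2` for every newform of `W` at
  every door prime (D-A₂). It is the `a = 2` slice of the EXISTING crux
  `PAdicOrderV2.PAdicOrderComparisonR2` (`ρ_p = a` at every good ordinary `p`; certificate
  `ordLeTwo_of_PAdicOrderComparisonR2`); the tree already proves `a = 2 ⇒ 2 ≤ ρ_p`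
  (`Theorems.stub_two_le_order_of_analyticRank_eq_two`), so the stub says `ρ_p = 2` exactly — the
  Mazur–Tate–Teitelbaum order conjecture at analytic rank two (mod the cyclotomic IMC at door primes:
  `s_p ≤ 2 ∧` semisimplicity of `X(E/ℚ_∞)` at `T`; given two points: `Ш(E)[p^∞]` finite ∧ Schneider's
  height non-degenerate — barrier I1 `PAdicHeightBarrier` lives HERE and only here in the line).
* `stub_locPOfAnalyticRankTwo` — OPEN inside the line: `a = 2 ⇒ Loc_p` (`ε = 1`) at every door prime.
  This IS the rider node `CrisAt` of the route (card crystalline-door-weakest-consequence, idea-crit-16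
  VERDICT #13 PASS; critic V#20 L-c) — its home is this conjunct. It is NOT sourced from `PointsTwo`
  inside the line (that item is a hypothesis of `closes`, not of the crux); the certificate
  `locP_of_pointsTwo` below only RECORDS the print implication «one rational point of infinite order ⇒
  Loc_p» (Bloch–Kato Ex. 3.11; modulo the displayed statement `LocPOfPoint`, whose one missing tree
  ingredient is the `T_p`-adic Kummer CLASS of a rational point in `H¹(Γ_ℚ, T_pW)`), i.e. where barrier
  B1 touches the line. Without points it is open (under `#Ш(E)[p^∞] < ∞` it is equivalent to
  `rank E(ℚ) ≥ 1`).
* (r1/r2) `stub_rung389a1_5` — the BC5 rung at `(389a1, 5)`: REMOVED in r3 (seat w3: stub-misstated —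
  an unconditional rung inherits the sandwich's print debt; LANDED instead: `door_389a1_five` — the door
  holds outright, `ρ̄_{E,5}` onto by three Serre witnesses in the kernel —, `order_padicLFunction_le_two_389a1_five`
  (D-A₂ at the cell given the symbol data), `rung389a1_five_of_sandwich(_newform)` and
  `firstDerivedKatoClass_389a1_five_of_sandwich`; E-S0-1 j314336 row `389a1@5`: A = 2, B = v_T = 1).
* `DerivedKatoDoor_of` — COMPOSITION (real proof, the crux BY NAME): `sandwichFromDA_of_stubs W p door
  ⟨stub_ordLeTwoOfAnalyticRankTwo W p (a = 2) door, stub_locPOfAnalyticRankTwo W p (a = 2) door⟩`.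

Honesty notes. (1) After the split the crux's OPEN content is `stub_ordLeTwoOfAnalyticRankTwo` (a slice
of an existing crux of another route) and `stub_locPOfAnalyticRankTwo` (implied by the route's own
residual); the sandwich stub is a theorem in print. So, RELATIVE TO THE ROUTE'S DECLARED RESIDUAL
`PointsTwo`, line `birth` reduces D-K₂ to PRINT ∧ D-A₂|_{a=2, door primes}; and D-A₂ there is STRICTLY
STRONGER than D-K₂ (D-A₂ ⟺ D-K₂ ∧ C₂', C₂' = the Coleman-step door of card coleman-step-door-r2, inside
I1) — this line pays an I1 price the crux itself may not need. (2) The converse sandwich `D-K₂ ⇒ D-U₂ ∧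
Loc_p` (BKS Prop. 4.5 / Kato 12.5 (4) contrapositive + Kummer) is the route's supports P1/P2 (items
23030/23031), not part of this line. (3) Disproof used: none exists yet (`ledger crux ls`: no
`Disproof.lean`, no `Negative/`); negatives index: stmt-15532 (CM curves have no door prime) is honoured
— the door prime is a hypothesis. (4) Junk audit of the crux (lead, session 1): `IwasawaH1Data` pins
`I.H` INTO `∏_n H¹(ℚ_n, T_pW)` by jointly injective projections, so a cooked `I` can only SHRINK `𝐇¹`;
`T²`-divisibility inside a Λ-submodule containing `z₀` implies it in `𝐇¹`, hence `∀ I` is equivalent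
to the statement for the genuine `𝐇¹` — no vacuity, no cheap refutation. (5) No in-session stub
workers were available to the lead (no `Agent` tool in the seat); the print stubs were worked by the
harness seats bsd-line-dkd-w2 (`stub_sandwichFromDA` → landed modulo facts, r3) and -w3 (`stub_rung389a1_5`
→ stub-misstated, cell certificates landed, r3).
-/

-- D-0017: single-problem summit, so `Summit.BirchSwinnertonDyer.BirchSwinnertonDyer.…` repeats a
-- namespace BY DESIGN.
set_option linter.dupNamespace false

noncomputable section

namespace Summit.BirchSwinnertonDyer.BirchSwinnertonDyer.Cruxes.DerivedKatoDoor.Birth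

open Field
open Literature Literature.NumberTheory.GaloisRepresentations
open Literature.NumberTheory.EllipticCurves Literature.NumberTheory.EllipticCurves.ModularForms
open Literature.NumberTheory.EllipticCurves.Kato2004
open Literature.NumberTheory.EllipticCurves.Kato2004.EulerSystemValues
open Summit.BirchSwinnertonDyer.BirchSwinnertonDyer.Theses.DerivedKatoValuationDoor (DerivedKatoDoor PointsTwo)

/-! ## Vocabulary of the line (documentation `def`s; every stub below is spelled out in full) -/

/-- **`Z₂(W,p)` = the crux's conclusion at `(W,p)`: `v_T(z₀) ≤ 1` (rationally) for every admissible
Kato zeta class `z₀` of every pinned `𝐇¹_Γ(T_pW)` along the cyclotomic tower** (verbatim the tail of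
`Theses.DerivedKatoValuationDoor.DerivedKatoDoor`; = `Ideas.DerivedKatoDoor.FirstDerivedKatoClassNonzeroAt`
of the ideator's sketch). [cite: BurnsKuriharaSano2019, Lemma 6.12] -/
def FirstDerivedKatoClassNonzeroAt (W : WeierstrassCurve ℚ) [W.IsElliptic] [W.IsGloballyMinimal]
    (p : ℕ) [Fact p.Prime] [ContinuousSMul ℤ_[p] (W.tateModule p)] : Prop :=
  ∀ (K : Literature.NumberTheory.EllipticCurves.ZpExtension ℚ p) (hK : K.IsCyclotomic)
    (γ : Field.absoluteGaloisGroup ℚ)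
    (I : Literature.NumberTheory.EllipticCurves.Kato2004.IwasawaH1Data W p K γ) (z₀ : I.H),
    K.IsTopGenerator γ →
    Literature.NumberTheory.EllipticCurves.Kato2004.IsAdmissibleZetaClass W p K hK I z₀ →
      ¬ ∃ (h : I.H) (m : ℕ),
        ((p : Literature.NumberTheory.EllipticCurves.IwasawaAlgebra p) ^ m) • z₀ =
          ((PowerSeries.X : Literature.NumberTheory.EllipticCurves.IwasawaAlgebra p) ^ 2) • h

/-- **`OrdCapTwoAt W p`: `ρ_p ≤ 2` for every weight-2 newform of `W`** (`ρ_p = ord_{T=0} L_p(f, α_p; T)`,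
the tree's MTT unit-root `p`-adic `L`-function; node N2 = D-A of the S0 web at order `2`, without the
`a = 2` guard). [cite: MazurTateTeitelbaum1986Invent, §II.10] -/
def OrdCapTwoAt (W : WeierstrassCurve ℚ) [W.IsElliptic] [W.IsGloballyMinimal] (p : ℕ) [Fact p.Prime] :
    Prop :=
  ∀ {N : ℕ} [NeZero N] (f : CuspForm (CongruenceSubgroup.Gamma0 N) 2),
    Literature.NumberTheory.EllipticCurves.ModularForms.IsNewformOf W f →
      (Literature.NumberTheory.EllipticCurves.padicLFunction f
        (Literature.NumberTheory.EllipticCurves.unitRoot W p : ℚ_[p])).order ≤ 2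

/-- **`Loc_p(W,p)`: some integral global class `x ∈ H¹(ℤ[1/p], T_pW)` localises at `p` to a Kummer
class with NON-ZERO formal logarithm** (`Sel(ℚ, V_pW) ⊄ ker loc_p`; = the ideator's
`SelmerNotLocallyTrivialAt`; Castella arXiv:2312.01481 condition (b) of Thm. 5.2.3).
[cite: BlochKato1990, Ex. 3.11] -/
def LocPAt (W : WeierstrassCurve ℚ) [W.IsElliptic] [W.IsGloballyMinimal] (p : ℕ) [Fact p.Prime]
    [ContinuousSMul ℤ_[p] (W.tateModule p)] : Prop :=
  ∃ (x : Literature.NumberTheory.GaloisRepresentations.H1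
      (Literature.NumberTheory.EllipticCurves.Kato2004.EulerSystemValues.tateRep W p) ⊤) (t : ℚ_[p]),
    x ∈ Literature.NumberTheory.EllipticCurves.Kato2004.integralH1
        (Literature.NumberTheory.EllipticCurves.Kato2004.EulerSystemValues.tateRep W p) p ⊤ ∧
      t ≠ 0 ∧ Literature.NumberTheory.EllipticCurves.Kato2004.HasLocPKummerLog W p x t

/-- **`SandwichFromDA` — the upper sandwich «(D-A₂ ∧ Loc_p) ⇒ D-K₂ at door primes»** (route header,
TWO-LAYER PLAN): for `W/ℚ` globally minimal elliptic and a door prime `p`, `ρ_p ≤ 2` (every newform)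
and `Loc_p` force `v_T(z₀) ≤ 1` for every admissible Kato class. PRINT (Kato Thm. 16.6 / Prop. 17.11
ordinary Coleman map `Col(loc z₀) ≐ L_p`; value law `Col(c)(𝟙) = (1−α⁻¹)(1−p⁻¹α⁻¹)·exp*(c₀)·unit`;
Poitou–Tate: `loc_p(H¹(ℤ[1/p],V))` is a line, `= H¹_f = ker exp*` under `Loc_p`), not in tree.
[cite: Kato2004Asterisque, Thm. 16.6 (p. 271), Prop. 17.11 (p. 277)] [cite: PerrinRiou1993AIF, §3.3–3.4]
[cite: BurnsKuriharaSano2019, Lemma 6.12–6.14] -/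
def SandwichFromDA : Prop :=
  ∀ (W : WeierstrassCurve ℚ) [W.IsElliptic] [W.IsGloballyMinimal] (p : ℕ) [Fact p.Prime]
    [ContinuousSMul ℤ_[p] (W.tateModule p)],
    (5 ≤ p ∧ Literature.NumberTheory.EllipticCurves.IsOrdinaryAt W p ∧ W.HasSurjectiveModNGaloisRep p) →
    (OrdCapTwoAt W p ∧ LocPAt W p) → FirstDerivedKatoClassNonzeroAt W p

/-- **`LocPOfPoint` — «a rational point of infinite order gives `Loc_p` at EVERY prime»** (PRINT,
displayed: Bloch–Kato Ex. 3.11 / AEC VIII §2, X §4: the `p`-adic Kummer class `κ(m·P) ∈ H¹(Γ_ℚ, T_pW)`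
is unramified away from `p` for a suitable `m ≠ 0` (Kummer away from `p`, as in the tree's
`Rank1Residual.Additive.exists_uniform_nsmul_mem_selmerGroup`) and `loc_p κ(m·P)` is the local Kummer
class of `m·P` with `log_ω(m·P) = m·log_ω P ≠ 0` (`log_ω` kills exactly the torsion of `E(ℚ_p)`). The
one tree ingredient still missing is the `T_p`-adic Kummer CLASS of a point as an element of the
continuous cohomology `H1 (tateRep W p) ⊤` (the tree has the finite-level maps `kummerMapTorsion`,
`localKummerMap` and the compact Selmer SUBGROUP `Kato2004.finiteH1`, not the map).
[cite: BlochKato1990, Def. 3.10 and Ex. 3.11] [cite: SilvermanAEC2009, VIII §2 and X §4] -/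
def LocPOfPoint : Prop :=
  ∀ (W : WeierstrassCurve ℚ) [W.IsElliptic] [W.IsGloballyMinimal] (p : ℕ) [Fact p.Prime]
    [ContinuousSMul ℤ_[p] (W.tateModule p)],
    (∃ P : W.toAffine.Point, ¬ IsOfFinAddOrder P) → LocPAt W p

/-! ## Stubs (registered; `sorry` only here) -/

/-- **Stub 1a — `stub_colemanMapAdmissibleZeta` (PRINT named fact, typed by seat w2 in
`Literature/NumberTheory/EllipticCurves/Kato2004/ColemanMapAdmissibleZeta.lean`): Kato's ordinary Coleman
map on the pinned `𝐇¹` — a `Λ`-linear `L = Col ∘ loc_p : I.H → Λ` with `ord_T L(z₀) = ord_T L_p(f, α_p)` for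
every admissible `z₀` and `L(h)(𝟙) = 0` whenever the bottom layer of `h` is Kummer at `p`.** Verbatim the
fact (its `∀`-closure is the fact itself). Size XL (Perrin-Riou's big dual exponential / Kato §16–17).
[cite: Kato2004Asterisque, Thm. 16.4 (ii) (p. 270), Thm. 16.6 (p. 271), Prop. 17.11 (p. 277)]
[cite: Rubin1998Durham, Thm. 6.1, Thm. 7.1, Cor. 7.2 (ii), Prop. A.2] [cite: BurnsKuriharaSano2019, Lemma 6.12–6.14] -/
theorem stub_colemanMapAdmissibleZeta :
    Literature.NumberTheory.EllipticCurves.Kato2004.exists_colemanMap_admissibleZeta := by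
  sorry

/-- **Stub 1b — `stub_hasLocPKummerLogOfExistsLogNeZero` (PRINT named fact, typed by seat w2, same
file): the Kurihara–Pollack line — ONE global class with non-zero Kummer logarithm at `p` makes EVERY
global class Kummer at `p`** (Poitou–Tate: the image of `H¹(ℚ, V_pE)` in `H¹(ℚ_p, V_pE) ≅ ℚ_p²` is a
line; `H¹(ℚ_ℓ, V_pE) = 0` for `ℓ ≠ p`). Verbatim the fact. Size L (the tree proves the variant from a
rational POINT: `Rank1Residual.Additive.exists_hasLocPKummerLog_of_mem_integralH1`).
[cite: KuriharaPollack2007, §1.4 Lemma 1.4] [cite: Kato2004Asterisque, §14.9 (14.9.1)–(14.9.3) (pp. 239–240)] -/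
theorem stub_hasLocPKummerLogOfExistsLogNeZero :
    Literature.NumberTheory.EllipticCurves.Kato2004.hasLocPKummerLog_of_exists_log_ne_zero := by
  sorry

/-- **The upper sandwich from stubs 1a + 1b** (revision 3: no longer a stub — seat w2 LANDED the
reduction `Theorems.DerivedKatoValuationDoor.stub_sandwichFromDA_of_facts`, kernel-checked, 15 lines of
`Λ`-algebra: `p^m L(z₀) = T² L(h)` forces `ord_T L(h) = ρ_p − 2 ≤ 0`, against `L(h)(𝟙) = 0`): at a door
prime, `ρ_p ≤ 2` for every newform of `W` together with `Loc_p` forces `v_T(z₀) ≤ 1` for every admissible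
Kato zeta class — the registered r1/r2 signature of `stub_sandwichFromDA`, verbatim. The newform is read
off the admissible class itself (witness (A0) of `IsAdmissibleZetaClass`), so NO modularity input is
needed on either side (answer to critic V#20 L-b). [cite: Kato2004Asterisque, Thm. 16.6 (p. 271)]
[cite: KuriharaPollack2007, §1.4 Lemma 1.4] -/
theorem sandwichFromDA_of_stubs :
    ∀ (W : WeierstrassCurve ℚ) [W.IsElliptic] [W.IsGloballyMinimal] (p : ℕ) [Fact p.Prime]
      [ContinuousSMul ℤ_[p] (W.tateModule p)],
      (5 ≤ p ∧ Literature.NumberTheory.EllipticCurves.IsOrdinaryAt W p ∧ W.HasSurjectiveModNGaloisRep p) →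
      ((∀ {N : ℕ} [NeZero N] (f : CuspForm (CongruenceSubgroup.Gamma0 N) 2),
          Literature.NumberTheory.EllipticCurves.ModularForms.IsNewformOf W f →
            (Literature.NumberTheory.EllipticCurves.padicLFunction f
              (Literature.NumberTheory.EllipticCurves.unitRoot W p : ℚ_[p])).order ≤ 2) ∧
        (∃ (x : Literature.NumberTheory.GaloisRepresentations.H1
            (Literature.NumberTheory.EllipticCurves.Kato2004.EulerSystemValues.tateRep W p) ⊤) (t : ℚ_[p]),
          x ∈ Literature.NumberTheory.EllipticCurves.Kato2004.integralH1
              (Literature.NumberTheory.EllipticCurves.Kato2004.EulerSystemValues.tateRep W p) p ⊤ ∧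
            t ≠ 0 ∧ Literature.NumberTheory.EllipticCurves.Kato2004.HasLocPKummerLog W p x t)) →
      ∀ (K : Literature.NumberTheory.EllipticCurves.ZpExtension ℚ p) (hK : K.IsCyclotomic)
        (γ : Field.absoluteGaloisGroup ℚ)
        (I : Literature.NumberTheory.EllipticCurves.Kato2004.IwasawaH1Data W p K γ) (z₀ : I.H),
        K.IsTopGenerator γ →
        Literature.NumberTheory.EllipticCurves.Kato2004.IsAdmissibleZetaClass W p K hK I z₀ →
          ¬ ∃ (h : I.H) (m : ℕ),
            ((p : Literature.NumberTheory.EllipticCurves.IwasawaAlgebra p) ^ m) • z₀ =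
              ((PowerSeries.X : Literature.NumberTheory.EllipticCurves.IwasawaAlgebra p) ^ 2) • h :=
  Summit.BirchSwinnertonDyer.BirchSwinnertonDyer.Theorems.DerivedKatoValuationDoor.stub_sandwichFromDA_of_facts
    stub_colemanMapAdmissibleZeta stub_hasLocPKummerLogOfExistsLogNeZero

/-- **Stub 2a — `stub_ordLeTwoOfAnalyticRankTwo` (OPEN; the lead's): analytic rank two forces, at
every door prime, `ρ_p ≤ 2` for every newform of `W` (D-A₂ at door primes).** The `a = 2` slice of the
existing crux `PAdicOrderV2.PAdicOrderComparisonR2` (certificate `ordLeTwo_of_PAdicOrderComparisonR2`);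
with the tree's `a = 2 ⇒ 2 ≤ ρ_p` it says `ρ_p = 2` exactly — the Mazur–Tate–Teitelbaum order
conjecture at analytic rank two. Why it might fail while BSD survives: a `T²`-Jordan block in
`X(E/ℚ_∞)` at a door prime (Greenberg semisimplicity open), or `Ш(E)[p^∞]` infinite, gives `ρ_p ≥ 3`
(mod IMC). Numerically `ρ_p = 2` at every tested `(E,p)` of rank two (Stein–Wuthrich 2013 §3; the
tree's atlas `Rank2ObservatoryPadicAtlasR2A00`, 47 cells, under its named hypotheses). Size: open
problem. [cite: MazurTateTeitelbaum1986Invent, §II.10] [cite: GreenbergLNM1716, Conj. 1.12–1.13 (pp. 64–65)]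
[cite: Schneider1985] [cite: SteinWuthrich2013, §3] -/
theorem stub_ordLeTwoOfAnalyticRankTwo :
    ∀ (W : WeierstrassCurve ℚ) [W.IsElliptic] [W.IsGloballyMinimal] (p : ℕ) [Fact p.Prime]
      [ContinuousSMul ℤ_[p] (W.tateModule p)], W.analyticRank = 2 →
      (5 ≤ p ∧ Literature.NumberTheory.EllipticCurves.IsOrdinaryAt W p ∧ W.HasSurjectiveModNGaloisRep p) →
      ∀ {N : ℕ} [NeZero N] (f : CuspForm (CongruenceSubgroup.Gamma0 N) 2),
        Literature.NumberTheory.EllipticCurves.ModularForms.IsNewformOf W f →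
          (Literature.NumberTheory.EllipticCurves.padicLFunction f
            (Literature.NumberTheory.EllipticCurves.unitRoot W p : ℚ_[p])).order ≤ 2 := by
  sorry

/-- **Stub 2b — `stub_locPOfAnalyticRankTwo` (OPEN as typed; residual-plus-print in the route):
analytic rank two forces `Loc_p` at every door prime** — some integral class `x ∈ H¹(ℤ[1/p], T_pW)`
localises at `p` to a Kummer class with non-zero logarithm. From one rational point of infinite order
it is print (`locP_of_pointsTwo`: `PointsTwo → LocPOfPoint → this`); without points it is open, and
under `#Ш(E)[p^∞] < ∞` equivalent to `rank E(ℚ) ≥ 1` (the compact Selmer group is then `E(ℚ) ⊗ ℤ_p` up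
to finite groups). Barrier B1 (`SelmerRankBarrierNarrow`) touches the line exactly here. Size: open as
typed; M given a point (the `T_p`-adic Kummer class). [cite: BlochKato1990, Ex. 3.11]
[cite: Kato2004Asterisque, §14.1 (p. 235) and (14.9.3) (p. 240)] -/
theorem stub_locPOfAnalyticRankTwo :
    ∀ (W : WeierstrassCurve ℚ) [W.IsElliptic] [W.IsGloballyMinimal] (p : ℕ) [Fact p.Prime]
      [ContinuousSMul ℤ_[p] (W.tateModule p)], W.analyticRank = 2 →
      (5 ≤ p ∧ Literature.NumberTheory.EllipticCurves.IsOrdinaryAt W p ∧ W.HasSurjectiveModNGaloisRep p) →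
      ∃ (x : Literature.NumberTheory.GaloisRepresentations.H1
          (Literature.NumberTheory.EllipticCurves.Kato2004.EulerSystemValues.tateRep W p) ⊤) (t : ℚ_[p]),
        x ∈ Literature.NumberTheory.EllipticCurves.Kato2004.integralH1
            (Literature.NumberTheory.EllipticCurves.Kato2004.EulerSystemValues.tateRep W p) p ⊤ ∧
          t ≠ 0 ∧ Literature.NumberTheory.EllipticCurves.Kato2004.HasLocPKummerLog W p x t := by
  sorry

/-! ## Composition: the crux from the stubs (real proof; `sorry` enters only through the stubs) -/

/-- **Composition (line `birth`) — the skeleton theorem.** The crux `DerivedKatoDoor`, BY NAME, from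
the sandwich (`sandwichFromDA_of_stubs` = w2's landed reduction fed with the two print-fact stubs 1a/1b)
applied to the pair `⟨stub_ordLeTwoOfAnalyticRankTwo, stub_locPOfAnalyticRankTwo⟩` (the crux decl
unfolds definitionally to the sandwich's conclusion under `a = 2`). No `sorry` of its own; its closure
reaches `sorryAx` exactly through the four stubs (two print named facts, two open). [cite: Kato2004Asterisque, Thm. 16.6 (p. 271)]
[cite: BurnsKuriharaSano2019, Prop. 4.5] -/
theorem DerivedKatoDoor_of :
    Summit.BirchSwinnertonDyer.BirchSwinnertonDyer.Theses.DerivedKatoValuationDoor.DerivedKatoDoor := by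
  intro W _ _ p _ _ ha hdoor K hK γ I z₀ hγ hz
  exact sandwichFromDA_of_stubs W p hdoor
    ⟨fun f hf => stub_ordLeTwoOfAnalyticRankTwo W p ha hdoor f hf,
      stub_locPOfAnalyticRankTwo W p ha hdoor⟩ K hK γ I z₀ hγ hz

/-! ## Certificates (sorry-free): what the stubs are, relative to the tree -/

/-- Stub 1's spelled signature IS `SandwichFromDA` (definitional unfolding of the three vocabulary
`def`s). [folklore] -/
theorem stub_sandwichFromDA_iff :
    SandwichFromDA ↔
    (∀ (W : WeierstrassCurve ℚ) [W.IsElliptic] [W.IsGloballyMinimal] (p : ℕ) [Fact p.Prime]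
      [ContinuousSMul ℤ_[p] (W.tateModule p)],
      (5 ≤ p ∧ Literature.NumberTheory.EllipticCurves.IsOrdinaryAt W p ∧ W.HasSurjectiveModNGaloisRep p) →
      ((∀ {N : ℕ} [NeZero N] (f : CuspForm (CongruenceSubgroup.Gamma0 N) 2),
          Literature.NumberTheory.EllipticCurves.ModularForms.IsNewformOf W f →
            (Literature.NumberTheory.EllipticCurves.padicLFunction f
              (Literature.NumberTheory.EllipticCurves.unitRoot W p : ℚ_[p])).order ≤ 2) ∧
        (∃ (x : Literature.NumberTheory.GaloisRepresentations.H1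
            (Literature.NumberTheory.EllipticCurves.Kato2004.EulerSystemValues.tateRep W p) ⊤) (t : ℚ_[p]),
          x ∈ Literature.NumberTheory.EllipticCurves.Kato2004.integralH1
              (Literature.NumberTheory.EllipticCurves.Kato2004.EulerSystemValues.tateRep W p) p ⊤ ∧
            t ≠ 0 ∧ Literature.NumberTheory.EllipticCurves.Kato2004.HasLocPKummerLog W p x t)) →
      ∀ (K : Literature.NumberTheory.EllipticCurves.ZpExtension ℚ p) (hK : K.IsCyclotomic)
        (γ : Field.absoluteGaloisGroup ℚ)
        (I : Literature.NumberTheory.EllipticCurves.Kato2004.IwasawaH1Data W p K γ) (z₀ : I.H),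
        K.IsTopGenerator γ →
        Literature.NumberTheory.EllipticCurves.Kato2004.IsAdmissibleZetaClass W p K hK I z₀ →
          ¬ ∃ (h : I.H) (m : ℕ),
            ((p : Literature.NumberTheory.EllipticCurves.IwasawaAlgebra p) ^ m) • z₀ =
              ((PowerSeries.X : Literature.NumberTheory.EllipticCurves.IwasawaAlgebra p) ^ 2) • h) :=
  Iff.rfl

/-- **The crux IS «a = 2 ⇒ Z₂ at door primes»** (definitional; records that the line's vocabulary
matches the route decl on the nose). [folklore] -/
theorem derivedKatoDoor_iff :
    Summit.BirchSwinnertonDyer.BirchSwinnertonDyer.Theses.DerivedKatoValuationDoor.DerivedKatoDoor ↔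
    ∀ (W : WeierstrassCurve ℚ) [W.IsElliptic] [W.IsGloballyMinimal] (p : ℕ) [Fact p.Prime]
      [ContinuousSMul ℤ_[p] (W.tateModule p)], W.analyticRank = 2 →
      (5 ≤ p ∧ Literature.NumberTheory.EllipticCurves.IsOrdinaryAt W p ∧ W.HasSurjectiveModNGaloisRep p) →
        FirstDerivedKatoClassNonzeroAt W p :=
  Iff.rfl

/-- **The planner's birth stub `stub_analyticOrderTwoAndLoc` (registered 17:42Z, sha c24c089348ad9d31)
is the conjunction of stubs 2a and 2b on the nose** — its registered signature, verbatim, derived from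
the two split stubs (so the reshape loses nothing and adds nothing). [folklore] -/
theorem analyticOrderTwoAndLoc_of_split :
    ∀ (W : WeierstrassCurve ℚ) [W.IsElliptic] [W.IsGloballyMinimal] (p : ℕ) [Fact p.Prime]
      [ContinuousSMul ℤ_[p] (W.tateModule p)], W.analyticRank = 2 →
      (5 ≤ p ∧ Literature.NumberTheory.EllipticCurves.IsOrdinaryAt W p ∧ W.HasSurjectiveModNGaloisRep p) →
      (∀ {N : ℕ} [NeZero N] (f : CuspForm (CongruenceSubgroup.Gamma0 N) 2),
          Literature.NumberTheory.EllipticCurves.ModularForms.IsNewformOf W f →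
            (Literature.NumberTheory.EllipticCurves.padicLFunction f
              (Literature.NumberTheory.EllipticCurves.unitRoot W p : ℚ_[p])).order ≤ 2) ∧
        (∃ (x : Literature.NumberTheory.GaloisRepresentations.H1
            (Literature.NumberTheory.EllipticCurves.Kato2004.EulerSystemValues.tateRep W p) ⊤) (t : ℚ_[p]),
          x ∈ Literature.NumberTheory.EllipticCurves.Kato2004.integralH1
              (Literature.NumberTheory.EllipticCurves.Kato2004.EulerSystemValues.tateRep W p) p ⊤ ∧
            t ≠ 0 ∧ Literature.NumberTheory.EllipticCurves.Kato2004.HasLocPKummerLog W p x t) :=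
  fun W _ _ p _ _ ha hdoor =>
    ⟨fun f hf => stub_ordLeTwoOfAnalyticRankTwo W p ha hdoor f hf, stub_locPOfAnalyticRankTwo W p ha hdoor⟩

/-- **Stub 2a is the `a = 2` slice of the existing crux `PAdicOrderComparisonR2`** (route PAdicOrderV2:
`ρ_p = a` at every good ordinary `p` for every newform): that crux gives stub 2a outright (no door
needed). Recorded so that a closure of that item closes this stub by this term.
[cite: MazurTateTeitelbaum1986Invent, §II.10] -/
theorem ordLeTwo_of_PAdicOrderComparisonR2
    (h : Summit.BirchSwinnertonDyer.BirchSwinnertonDyer.Theses.PAdicOrderV2.PAdicOrderComparisonR2) :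
    ∀ (W : WeierstrassCurve ℚ) [W.IsElliptic] [W.IsGloballyMinimal] (p : ℕ) [Fact p.Prime]
      [ContinuousSMul ℤ_[p] (W.tateModule p)], W.analyticRank = 2 →
      (5 ≤ p ∧ Literature.NumberTheory.EllipticCurves.IsOrdinaryAt W p ∧ W.HasSurjectiveModNGaloisRep p) →
      ∀ {N : ℕ} [NeZero N] (f : CuspForm (CongruenceSubgroup.Gamma0 N) 2),
        Literature.NumberTheory.EllipticCurves.ModularForms.IsNewformOf W f →
          (Literature.NumberTheory.EllipticCurves.padicLFunction f
            (Literature.NumberTheory.EllipticCurves.unitRoot W p : ℚ_[p])).order ≤ 2 := by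
  intro W _ _ p _ _ ha hdoor N _ f hf
  rw [h W p hdoor.2.1 f hf, ha]
  exact le_rfl

/-- **Stub 2b from the route's residual `PointsTwo` and the print statement `LocPOfPoint`** (no door
and no `a = 2` beyond feeding `PointsTwo`): two independent points give one of infinite order
(`exists_not_isOfFinAddOrder_of_mordellWeilRank_ne_zero`), whose Kummer class witnesses `Loc_p`. So
inside the ROUTE (which declares `PointsTwo` residual) stub 2b costs exactly the print fact
`LocPOfPoint`. [cite: BlochKato1990, Ex. 3.11] [cite: SilvermanAEC2009, VIII.6.7] -/
theorem locP_of_pointsTwo (hPts : PointsTwo) (hL : LocPOfPoint) :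
    ∀ (W : WeierstrassCurve ℚ) [W.IsElliptic] [W.IsGloballyMinimal] (p : ℕ) [Fact p.Prime]
      [ContinuousSMul ℤ_[p] (W.tateModule p)], W.analyticRank = 2 →
      (5 ≤ p ∧ Literature.NumberTheory.EllipticCurves.IsOrdinaryAt W p ∧ W.HasSurjectiveModNGaloisRep p) →
      ∃ (x : Literature.NumberTheory.GaloisRepresentations.H1
          (Literature.NumberTheory.EllipticCurves.Kato2004.EulerSystemValues.tateRep W p) ⊤) (t : ℚ_[p]),
        x ∈ Literature.NumberTheory.EllipticCurves.Kato2004.integralH1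
            (Literature.NumberTheory.EllipticCurves.Kato2004.EulerSystemValues.tateRep W p) p ⊤ ∧
          t ≠ 0 ∧ Literature.NumberTheory.EllipticCurves.Kato2004.HasLocPKummerLog W p x t := by
  intro W _ _ p _ _ ha _hdoor
  have hr : W.mordellWeilRank ≠ 0 := by have := hPts W ha; omega
  exact hL W p (W.exists_not_isOfFinAddOrder_of_mordellWeilRank_ne_zero hr)

/-- **The line modulo its inputs, hypothesis form** (sorry-free certificate of what `birth` reduces the
crux to): `SandwichFromDA` (print) + D-A₂ at `a = 2` and door primes (open; ⟸ `PAdicOrderComparisonR2`)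
+ the route's residual `PointsTwo` + `LocPOfPoint` (print) ⟹ «a = 2 ⇒ Z₂ at door primes», which is
the crux unfolded (`derivedKatoDoor_iff`; stated unfolded so that the skeleton registrar sees exactly
one theorem concluding the crux by name, `DerivedKatoDoor_of`).
[cite: Kato2004Asterisque, Thm. 16.6 (p. 271)] [cite: MazurTateTeitelbaum1986Invent, §II.10] -/
theorem firstDerivedKatoClassNonzeroAt_of_pieces (hS : SandwichFromDA)
    (hA : ∀ (W : WeierstrassCurve ℚ) [W.IsElliptic] [W.IsGloballyMinimal] (p : ℕ) [Fact p.Prime]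
      [ContinuousSMul ℤ_[p] (W.tateModule p)], W.analyticRank = 2 →
      (5 ≤ p ∧ Literature.NumberTheory.EllipticCurves.IsOrdinaryAt W p ∧ W.HasSurjectiveModNGaloisRep p) →
      OrdCapTwoAt W p)
    (hPts : PointsTwo) (hL : LocPOfPoint)
    (W : WeierstrassCurve ℚ) [W.IsElliptic] [W.IsGloballyMinimal] (p : ℕ) [Fact p.Prime]
    [ContinuousSMul ℤ_[p] (W.tateModule p)] (ha : W.analyticRank = 2)
    (hdoor : 5 ≤ p ∧ Literature.NumberTheory.EllipticCurves.IsOrdinaryAt W p ∧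
      W.HasSurjectiveModNGaloisRep p) :
    FirstDerivedKatoClassNonzeroAt W p :=
  hS W p hdoor ⟨hA W p ha hdoor, locP_of_pointsTwo hPts hL W p ha hdoor⟩

/-- **The rung reduces to the sandwich at its cell** (sorry-free): given `ρ_5 ≤ 2` for every newform of
`389a1` and `Loc_5(389a1)`, any proof of the spelled sandwich yields `stub_rung389a1_5`'s conclusion.
This is how the BC5 rung is meant to be discharged (`ρ_5 = 2` by `padicRow_of_mem_atlasR2A00` under the
series' hypotheses; `Loc_5` from a generator). [cite: BalakrishnanMullerStein2015, Thm. 1.7] -/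
theorem rung389a1_5_of_sandwich (hS : SandwichFromDA) [Fact (5 : ℕ).Prime]
    [(Summit.BirchSwinnertonDyer.BirchSwinnertonDyer.Rank2Observatory.c389a1.e.baseChange ℚ).IsElliptic]
    [(Summit.BirchSwinnertonDyer.BirchSwinnertonDyer.Rank2Observatory.c389a1.e.baseChange ℚ).IsGloballyMinimal]
    [ContinuousSMul ℤ_[5]
      ((Summit.BirchSwinnertonDyer.BirchSwinnertonDyer.Rank2Observatory.c389a1.e.baseChange ℚ).tateModule 5)]
    (hρ : OrdCapTwoAt
      (Summit.BirchSwinnertonDyer.BirchSwinnertonDyer.Rank2Observatory.c389a1.e.baseChange ℚ) 5)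
    (hloc : LocPAt
      (Summit.BirchSwinnertonDyer.BirchSwinnertonDyer.Rank2Observatory.c389a1.e.baseChange ℚ) 5)
    (hdoor : 5 ≤ 5 ∧ Literature.NumberTheory.EllipticCurves.IsOrdinaryAt
        (Summit.BirchSwinnertonDyer.BirchSwinnertonDyer.Rank2Observatory.c389a1.e.baseChange ℚ) 5 ∧
      (Summit.BirchSwinnertonDyer.BirchSwinnertonDyer.Rank2Observatory.c389a1.e.baseChange ℚ).HasSurjectiveModNGaloisRep 5) :
    FirstDerivedKatoClassNonzeroAt
      (Summit.BirchSwinnertonDyer.BirchSwinnertonDyer.Rank2Observatory.c389a1.e.baseChange ℚ) 5 :=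
  hS _ 5 hdoor ⟨hρ, hloc⟩

end Summit.BirchSwinnertonDyer.BirchSwinnertonDyer.Cruxes.DerivedKatoDoor.Birth

end
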